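import Mathlib
import Literature.Computability.AlgebraicComplexity.GroupTheoreticMatMul
import Summits.MatrixMultiplication.MatrixMultiplication.Theorems.AbelianSTPPCensusSubfamilyPacking

/-!
# A `(7,7,7)²` STPP pair at order `648`, and its isolation by pair-footprint packing (cell mm-stpp, eng-2 g6)

Companion of `AbelianSTPPCensusSubfamilyPacking` (the sub-family packing lemma) and of `AbelianSTPPCensusRoomRelaxation648` (single-member
room rules are silent on `(7,7,7)⁵` at `648`).

1. `isSTPP_subAxes_pair` — the Cohn–Kleinberg–Szegedy–Umans axes pair with ARBITRARY sub-blocks: in `ℤ/a × ℤ/b × ℤ/c`, member `0` with blocks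
   inside the punctured `x, y, z`-axes and member `1` with blocks inside the punctured `y, z, x`-axes form an `IsSTPP` family (lonely-coordinate
   argument of CKSU Prop. 5.2; the tree's `isSTPP_puncturedAxes_pair` is the full-axes, equal-moduli case).
2. The instance `P = (ℤ/8∖0)×0×0`, `Q = 0×(ℤ/9∖{0,1})×0`, `R = 0×0×(ℤ/9∖{0,1})` in `ℤ/8 × ℤ/9 × ℤ/9`: `(P,Q,R), (Q,R,P)` is an STPP pair of shapes
   `(7,7,7)²` in an abelian group of order `648` (`isSTPP_axesPair`) — so `(7,7,7)²` EXISTS at the top order of the `(7,7,7)⁵` beating window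
   `618–648` (the window's list is vQ-alive there, `AbelianSTPPCensusVQWitnesses`; nothing was known to exist).
3. `le_card_footprint_axesPair`, `third_member_small` — three of the pair's four `D`-world cross sets already cover `611 > 648 − 38` points
   (kernel evaluation), so by `STPPSubfamilyPacking.no_third_of_large_pair_footprint` ANY further member `t` of ANY STPP family containing
   this pair has `|A_t||B_t| ≤ 37`: the pair is isolated — it extends to no `(7,7,7)³` — by a genuinely TWO-member cardinality argument,
   while every single-member or shape-level rule of the cell is silent on `(7,7,7)³` at `648`.  (Seat computation, two codes: all sixteen
   sub-puncturings of this template give pairs with `D/E/F`-world footprints between `611` and `627`; the cell's search «PAIR648» measures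
   how small a `(7,7,7)²` pair footprint at order `648` can be — a `(7,7,7)⁵` family needs `≤ 501` for each of its ten pairs.)

WHAT THIS IS NOT: no `ω` statement; no census number; no claim about OTHER `(7,7,7)²` pairs at order `648` (whether some pair has footprint
`≤ 599`, i.e. room for a third member's difference set, is exactly the open computation); no non-existence claim for `(7,7,7)³` or `(7,7,7)⁵`.
-/

-- single-conjunct summit: the mandated namespace repeats `MatrixMultiplication`.
set_option linter.dupNamespace false
set_option autoImplicit false

namespace Summit.MatrixMultiplication.MatrixMultiplication.Theorems

namespace STPPPairAxes

open Finset Literature.Computability.AlgebraicComplexity STPPSubfamilyPacking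
open scoped Pointwise

/-! ## Sub-punctured axes pairs are STPP (any moduli, any sub-blocks of the punctured axes) -/

section general

variable {a b c : ℕ} {A₀ B₀ C₀ A₁ B₁ C₁ : Finset (ZMod a × ZMod b × ZMod c)}

/-- **Sub-punctured CKSU axes pairs are STPP.**  In `ℤ/a × ℤ/b × ℤ/c` let member `0` have its blocks `A₀, B₀, C₀` inside the punctured
`x`-, `y`-, `z`-axes and member `1` its blocks `A₁, B₁, C₁` inside the punctured `y`-, `z`-, `x`-axes (ANY subsets; «punctured» = the
block avoids `0`).  Then the two-member family is `IsSTPP`: the two constant patterns split into coordinates, and each of the six mixed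
patterns `(i,j,k)` of CKSU Def. 5.1 has a coordinate to which exactly one of the six elements contributes — a non-zero entry.  (The tree's
`isSTPP_puncturedAxes_pair` is the case `a = b = c`, full punctured axes, `A₁ = B₀`, `B₁ = C₀`, `C₁ = A₀`.)
[cite: CohnKleinbergSzegedyUmans2005, Prop. 5.2] -/
theorem isSTPP_subAxes_pair
    (hA₀ : ∀ v ∈ A₀, v.1 ≠ 0 ∧ v.2.1 = 0 ∧ v.2.2 = 0) (hB₀ : ∀ v ∈ B₀, v.2.1 ≠ 0 ∧ v.1 = 0 ∧ v.2.2 = 0)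
    (hC₀ : ∀ v ∈ C₀, v.2.2 ≠ 0 ∧ v.1 = 0 ∧ v.2.1 = 0) (hA₁ : ∀ v ∈ A₁, v.2.1 ≠ 0 ∧ v.1 = 0 ∧ v.2.2 = 0)
    (hB₁ : ∀ v ∈ B₁, v.2.2 ≠ 0 ∧ v.1 = 0 ∧ v.2.1 = 0) (hC₁ : ∀ v ∈ C₁, v.1 ≠ 0 ∧ v.2.1 = 0 ∧ v.2.2 = 0) :
    IsSTPP ![A₀, A₁] ![B₀, B₁] ![C₀, C₁] := by
  intro i j k s hs s' hs' t ht t' ht' u hu u' hu' h0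
  have h1 := congrArg Prod.fst h0
  have h2 := congrArg (fun v => v.2.1) h0
  have h3 := congrArg (fun v => v.2.2) h0
  simp only [Prod.fst_add, Prod.fst_sub, Prod.snd_add, Prod.snd_sub, Prod.fst_zero, Prod.snd_zero] at h1 h2 h3
  fin_cases i <;> fin_cases j <;> fin_cases k <;>
    simp only [Fin.zero_eta, Fin.mk_one, Fin.isValue, Matrix.cons_val_zero, Matrix.cons_val_one] at hs hs' ht ht' hu hu'
  · -- (0,0,0): s, s' ∈ A₀; t, t' ∈ B₀; u, u' ∈ C₀
    obtain ⟨-, hs2, hs3⟩ := hA₀ s hs; obtain ⟨-, hs'2, hs'3⟩ := hA₀ s' hs'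
    obtain ⟨-, ht1, ht3⟩ := hB₀ t ht; obtain ⟨-, ht'1, ht'3⟩ := hB₀ t' ht'
    obtain ⟨-, hu1, hu2⟩ := hC₀ u hu; obtain ⟨-, hu'1, hu'2⟩ := hC₀ u' hu'
    refine ⟨rfl, rfl, Prod.ext ?_ (Prod.ext ?_ ?_), Prod.ext ?_ (Prod.ext ?_ ?_), Prod.ext ?_ (Prod.ext ?_ ?_)⟩
    · linear_combination -h1 + ht'1 - ht1 + hu'1 - hu1
    · rw [hs2, hs'2]
    · rw [hs3, hs'3]
    · rw [ht1, ht'1]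
    · linear_combination -h2 + hs'2 - hs2 + hu'2 - hu2
    · rw [ht3, ht'3]
    · rw [hu1, hu'1]
    · rw [hu2, hu'2]
    · linear_combination -h3 + hs'3 - hs3 + ht'3 - ht3
  · -- (0,0,1): s ∈ A₁(y), s' ∈ A₀(x), t, t' ∈ B₀(y), u ∈ C₀(z), u' ∈ C₁(x); the z-coordinate sees only u
    exfalso; apply (hC₀ u hu).1
    linear_combination -h3 + (hA₀ s' hs').2.2 - (hA₁ s hs).2.2 + (hB₀ t' ht').2.2 - (hB₀ t ht).2.2 + (hC₁ u' hu').2.2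
  · -- (0,1,0): s, s' ∈ A₀(x), t ∈ B₀(y), t' ∈ B₁(z), u ∈ C₁(x), u' ∈ C₀(z); the y-coordinate sees only t
    exfalso; apply (hB₀ t ht).1
    linear_combination -h2 + (hA₀ s' hs').2.1 - (hA₀ s hs).2.1 + (hB₁ t' ht').2.2 + (hC₀ u' hu').2.2 - (hC₁ u hu).2.1
  · -- (0,1,1): s ∈ A₁(y), s' ∈ A₀(x), t ∈ B₀(y), t' ∈ B₁(z), u, u' ∈ C₁(x); the z-coordinate sees only t'
    exfalso; apply (hB₁ t' ht').1
    linear_combination h3 - (hA₀ s' hs').2.2 + (hA₁ s hs).2.2 + (hB₀ t ht).2.2 - (hC₁ u' hu').2.2 + (hC₁ u hu).2.2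
  · -- (1,0,0): s ∈ A₀(x), s' ∈ A₁(y), t ∈ B₁(z), t' ∈ B₀(y), u, u' ∈ C₀(z); the x-coordinate sees only s
    exfalso; apply (hA₀ s hs).1
    linear_combination -h1 + (hA₁ s' hs').2.1 + (hB₀ t' ht').2.1 - (hB₁ t ht).2.1 + (hC₀ u' hu').2.1 - (hC₀ u hu).2.1
  · -- (1,0,1): s, s' ∈ A₁(y), t ∈ B₁(z), t' ∈ B₀(y), u ∈ C₀(z), u' ∈ C₁(x); the x-coordinate sees only u'
    exfalso; apply (hC₁ u' hu').1
    linear_combination h1 - (hA₁ s' hs').2.1 + (hA₁ s hs).2.1 - (hB₀ t' ht').2.1 + (hB₁ t ht).2.1 + (hC₀ u hu).2.1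
  · -- (1,1,0): s ∈ A₀(x), s' ∈ A₁(y), t, t' ∈ B₁(z), u ∈ C₁(x), u' ∈ C₀(z); the y-coordinate sees only s'
    exfalso; apply (hA₁ s' hs').1
    linear_combination h2 + (hA₀ s hs).2.1 - (hB₁ t' ht').2.2 + (hB₁ t ht).2.2 - (hC₀ u' hu').2.2 + (hC₁ u hu).2.1
  · -- (1,1,1): s, s' ∈ A₁; t, t' ∈ B₁; u, u' ∈ C₁
    obtain ⟨-, hs1, hs3⟩ := hA₁ s hs; obtain ⟨-, hs'1, hs'3⟩ := hA₁ s' hs'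
    obtain ⟨-, ht1, ht2⟩ := hB₁ t ht; obtain ⟨-, ht'1, ht'2⟩ := hB₁ t' ht'
    obtain ⟨-, hu2, hu3⟩ := hC₁ u hu; obtain ⟨-, hu'2, hu'3⟩ := hC₁ u' hu'
    refine ⟨rfl, rfl, Prod.ext ?_ (Prod.ext ?_ ?_), Prod.ext ?_ (Prod.ext ?_ ?_), Prod.ext ?_ (Prod.ext ?_ ?_)⟩
    · rw [hs1, hs'1]
    · linear_combination -h2 + ht'2 - ht2 + hu'2 - hu2
    · rw [hs3, hs'3]
    · rw [ht1, ht'1]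
    · rw [ht2, ht'2]
    · linear_combination -h3 + hs'3 - hs3 + hu'3 - hu3
    · linear_combination -h1 + hs'1 - hs1 + ht'1 - ht1
    · rw [hu2, hu'2]
    · rw [hu3, hu'3]

end general

/-! ## The instance at order 648 and its pair footprints -/

/-- The host `ℤ/8 × ℤ/9 × ℤ/9` (abelian, order `648 = 2³·3⁴`). -/
abbrev G : Type := ZMod 8 × ZMod 9 × ZMod 9

/-- `P = (ℤ/8 ∖ {0}) × 0 × 0` — all seven non-zero points of the `x`-axis. -/
def ax : Finset G := (Finset.univ.erase (0 : ZMod 8)).image fun x => (x, 0, 0)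
/-- `Q = 0 × (ℤ/9 ∖ {0, 1}) × 0` — seven of the eight non-zero points of the `y`-axis. -/
def by_ : Finset G := ((Finset.univ.erase (0 : ZMod 9)).erase 1).image fun y => (0, y, 0)
/-- `R = 0 × 0 × (ℤ/9 ∖ {0, 1})`. -/
def cz : Finset G := ((Finset.univ.erase (0 : ZMod 9)).erase 1).image fun z => (0, 0, z)

/-- `|G| = 648`. [bookkeeping] -/
theorem card_G : Fintype.card G = 648 := by simp [G, Fintype.card_prod, ZMod.card]

/-- The three blocks have seven elements each. [bookkeeping] -/
theorem card_blocks : ax.card = 7 ∧ by_.card = 7 ∧ cz.card = 7 := by decide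

/-- **The pair `(P, Q, R), (Q, R, P)` is an STPP family of shapes `(7,7,7)²` in an abelian group of order `648`** — so
`k_max((7,7,7); order 648) ≥ 2` at the top order of the `(7,7,7)⁵` beating window. [original] -/
theorem isSTPP_axesPair : IsSTPP ![ax, by_] ![by_, cz] ![cz, ax] := by
  refine isSTPP_subAxes_pair ?_ ?_ ?_ ?_ ?_ ?_
  · intro v hv; simp only [ax, mem_image, mem_erase] at hv; obtain ⟨x, ⟨hx, -⟩, rfl⟩ := hv; exact ⟨hx, rfl, rfl⟩
  · intro v hv; simp only [by_, mem_image, mem_erase] at hv; obtain ⟨y, ⟨-, hy, -⟩, rfl⟩ := hv; exact ⟨hy, rfl, rfl⟩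
  · intro v hv; simp only [cz, mem_image, mem_erase] at hv; obtain ⟨z, ⟨-, hz, -⟩, rfl⟩ := hv; exact ⟨hz, rfl, rfl⟩
  · intro v hv; simp only [by_, mem_image, mem_erase] at hv; obtain ⟨y, ⟨-, hy, -⟩, rfl⟩ := hv; exact ⟨hy, rfl, rfl⟩
  · intro v hv; simp only [cz, mem_image, mem_erase] at hv; obtain ⟨z, ⟨-, hz, -⟩, rfl⟩ := hv; exact ⟨hz, rfl, rfl⟩
  · intro v hv; simp only [ax, mem_image, mem_erase] at hv; obtain ⟨x, ⟨hx, -⟩, rfl⟩ := hv; exact ⟨hx, rfl, rfl⟩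

set_option maxHeartbeats 0 in
/-- Kernel evaluation: the two room sets and one cross set of the axes pair, `X₀₀ ∪ X₁₁ ∪ X₁₀` with `X₀₀ = (P − Q) + (R − R)`,
`X₁₁ = (Q − R) + (P − P)`, `X₁₀ = (P − R) + (P − R) = (P + P) − (R + R)` (the last written as the `72`-point box it is, to keep the kernel
evaluation small), cover `611` of the `648` group elements.  (All four cross sets cover `618` — seat computation in two codes; the fourth set
`X₀₁ = (Q − Q) + (R − P)` is left out of the kernel evaluation for size.) [original] -/
theorem card_three_crossSets :
    (((ax - by_) + (cz - cz)) ∪ ((by_ - cz) + (ax - ax)) ∪ ((ax + ax) - (cz + cz))).card = 611 := by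
  decide +kernel

/-- **The `D`-world pair footprint of the axes pair has at least `611 > 648 − 49` elements.** [original] -/
theorem le_card_footprint_axesPair : 611 ≤ (footprint ![ax, by_] ![by_, cz] ![cz, ax] univ).card := by
  rw [← card_three_crossSets]
  refine card_le_card (union_subset (union_subset ?_ ?_) ?_)
  · exact crossSet_subset_footprint (A := ![ax, by_]) (B := ![by_, cz]) (C := ![cz, ax]) (j := 0) (k := 0) (mem_univ _) (mem_univ _)
  · exact crossSet_subset_footprint (A := ![ax, by_]) (B := ![by_, cz]) (C := ![cz, ax]) (j := 1) (k := 1) (mem_univ _) (mem_univ _)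
  · rw [← sub_add_sub_comm ax cz ax cz]
    exact crossSet_subset_footprint (A := ![ax, by_]) (B := ![by_, cz]) (C := ![cz, ax]) (j := 1) (k := 0) (mem_univ _) (mem_univ _)

/-- **The axes pair is isolated.**  In ANY `IsSTPP` family in `ℤ/8 × ℤ/9 × ℤ/9` (all `C_t` non-empty) two of whose members are the axes
triples `(P, Q, R)` and `(Q, R, P)`, every other member `t` has `|A_t|·|B_t| ≤ 37` — by sub-family packing
(`STPPSubfamilyPacking.no_third_of_large_pair_footprint`): its difference set `A_t − B_t` must avoid the pair footprint, which has `≥ 611`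
elements.  In particular the pair extends to no `(7,7,7)³` family (cf. the maximality of CKSU's full punctured-axes pair, `prop52_pair_maximal`),
although at order `648 ≥ 3·147` every packing / room / energy rule of the cell is silent on the SHAPE list `(7,7,7)³`. [original] -/
theorem third_member_small {N : ℕ} {A B C : Fin N → Finset G} (hS : IsSTPP A B C) (hC : ∀ t, (C t).Nonempty)
    {j k t : Fin N} (hj : A j = ax ∧ B j = by_ ∧ C j = cz) (hk : A k = by_ ∧ B k = cz ∧ C k = ax) (htj : t ≠ j) (htk : t ≠ k) :
    (A t).card * (B t).card ≤ 37 := by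
  have hjS : j ∈ ({j, k} : Finset (Fin N)) := by simp
  have hkS : k ∈ ({j, k} : Finset (Fin N)) := by simp
  have hsub : ((ax - by_) + (cz - cz)) ∪ ((by_ - cz) + (ax - ax)) ∪ ((ax + ax) - (cz + cz)) ⊆ footprint A B C {j, k} := by
    refine union_subset (union_subset ?_ ?_) ?_
    · have h := crossSet_subset_footprint (A := A) (B := B) (C := C) hjS hjS
      rwa [crossSet_eq, hj.1, hj.2.1, hj.2.2] at h
    · have h := crossSet_subset_footprint (A := A) (B := B) (C := C) hkS hkS
      rwa [crossSet_eq, hk.1, hk.2.1, hk.2.2] at h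
    · have h := crossSet_subset_footprint (A := A) (B := B) (C := C) hkS hjS
      rwa [crossSet_eq, hj.1, hk.2.1, hk.2.2, hj.2.2, sub_add_sub_comm ax cz ax cz] at h
  have hfp : 611 ≤ (footprint A B C {j, k}).card := by
    rw [← card_three_crossSets]; exact card_le_card hsub
  have h := no_third_of_large_pair_footprint hS hC htj htk (q := 38)
    (by have : Fintype.card G = 648 := card_G; omega)
  omega

end STPPPairAxes

end Summit.MatrixMultiplication.MatrixMultiplication.Theorems
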